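import Summits.QuantumFields.BalabanUV.Beta.GAN24.OneStepConstraintAxialVolumeProp

/-!
# `BalabanUV.Beta.GAN24.OneStepConstraintAxialVolumeLimit` — binder row G-an2-4 ∕ (CONV-C), routes C-R6° («VALUES») × R7 («TWO CURRENCIES»), PART 189:
# EL₂ OF THE GAUGE-FIXED FLUCTUATION COVARIANCE `𝒢_t = flucCov(H_t, Q_ax)` AT FINE READINGS, FOR ANY LOCALISED FINE FORM FAMILY.  Completing PARTs 187–188 along cubic coarse
# tori `M = cubic d (s t)`, `s t → ∞`: by an2's bordered-inverse algebra (PART 186 `blocks_eq_of_ub`) `𝒢 = K⁻¹ − ℋ·(Q_axK⁻¹)` with `ℋ = K⁻¹Q_axᵀP⁻¹` the hard minimiser, so at fine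
# readings `𝒢_t(ρ(ẑ,f), ρ(ẑ′,f′))` is `K_t⁻¹(ρ(ẑ,f), ρ(ẑ′,f′))` (EL₂ by PART 187) minus a rectangular pair product over the presented stacked index of `ℋ_t` (bounded: PART 180's minimiser
# letter; EL₂: itself the product of the decaying soft columns `K_t⁻¹Q_axᵀ` (PART 188 §2) with the bounded `P_t⁻¹` (PART 188 §4)) and `Q_axK_t⁻¹` (decaying: the soft columns
# transposed).  Hypotheses on `H_t` exactly as in PART 188 — every one is discharged for `H = re Δ_n` in PART 190 — census V201′ (ε), step 3 (unit b2b-balaban-gan24-p3, gen 61; v1)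

NOT IN PRINT; OUR PROOF ([folklore] bookkeeping BY NAME over PART 185 (`tendsto_mul_pair₃`, `tendsto_mul_pair₃'`, `exp_neg_tdist_le_exp_window'`), PART 186 (`rho_bijective`, `eps_bijective`, `key_eps`,
`blocks_eq_of_ub`), PART 187 (`tendsto_inv_regFormAx_rho`), PART 188 (`tendsto_inv_mul_transpose_rho_eps`, `tendsto_inv_blockProp_eps`), PART 180 `OneStepConstraintAxialLocalisation`
(`abs_inv_mul_transpose_le_QB_axial`, `abs_minOp_le_QB_axial`, `ub_QB_axial`), PART 181 (`form_le_of_entry_decay_par`, `not_corner_of_tree`), PART 105 (`transpose_reg`, `blockProp_coercive_of_ub`),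
PART 106 `FluctuationCovarianceLocalisation.mul_inv_apply_eq`, `QGQInverse.inv_entry_le_of_coercive`, `B4Sect5Torus.rate_pos`; [Balaban1984PropagatorsII] (2.152)–(2.157) pp. 249–250 and
[Balaban1987RG1] p. 264 (after (1.21)) LOCATE the objects; nothing printed is a hypothesis).
HONEST FRAMING (cell contract, verbatim): «discharging `BetaPertH` makes Bałaban's UV stability UNCONDITIONAL — a real constructive-QFT result; it is NOT the
continuum limit and NOT the Clay problem.»  HONEST DEPENDENCY (verbatim): «continuum YM on T⁴ ⇐ BetaPertH ∧ nine spine estimates (0/9 proved); BetaPertH ⇐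
(D1) ∧ (D4) ∧ CAP+tail; G-an2-4 gates asym, D1 and NE2/3/4.»

WHAT THIS FILE PROVES (0 sorry, 0 `def`; `N, R ≥ 1`, `d ≥ 1`, every cubic volume sequence `s t → ∞`; `ẑ = castT (fine N (cubic d (s t))) z`, `ρ`, `ε` of PART 186):
* **`tendsto_minOp_rho_eps`** — EL₂ of the hard minimiser `ℋ_t(ρ(ẑ,f), ε(ẑ′,g))`.
* **`tendsto_flucCov_rho`** — EL₂ OF THE GAUGE-FIXED FLUCTUATION COVARIANCE AT FINE READINGS: for a volume-indexed family `H_t` of symmetric fine forms with nonnegative form, `t`-uniform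
  block entry decay `(h₀, δ_H)`, `t`-uniform site profile `Kf`, `t`-uniform coercivity `γ_K` of `K_t = H_t + Q_axᵀ(a•1)Q_ax` and EL₂ at fine readings,
  `∀ f f′ z z′, ∃ c, flucCov (H_t) (Q_ax,t) (ρ(ẑ,f)) (ρ(ẑ′,f′)) → c`.
WHAT IT IS NOT: the instantiation `H = re Δ_n` (PART 190); the identification of the limit; rates in the volume.  SUPPLIER work; NEVER «G-an2-4 closed»; NOT (CONV-C), NOT D1,
NOT `BetaPertH`, NOT continuum, NOT Clay.  Records: `HOME/b2b-balaban-gan24-p3/gen61/README.md`.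
-/

noncomputable section

open scoped BigOperators ComplexConjugate Matrix Matrix.Norms.L2Operator
open Filter Topology Finset Matrix

namespace Summit.QuantumFields.BalabanUV.Beta.GAN24.OneStepConstraintAxialVolumeLimit

open Literature.MathematicalPhysics.QuantumFieldTheory.Balaban1983to89
open Literature.MathematicalPhysics.QuantumFieldTheory.Balaban1983to89.B4Sect5Torus (rate rate_pos)
open Literature.MathematicalPhysics.QuantumFieldTheory.Balaban1983to89.B12Sec2to5 (l1)
open Literature.MathematicalPhysics.QuantumFieldTheory.Balaban1983to89.B5Prop11Plancherel (Tor fine)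
open Literature.MathematicalPhysics.QuantumFieldTheory.Balaban1983to89.B5RealFields (reM reM_apply)
open Literature.MathematicalPhysics.QuantumFieldTheory.Balaban1983to89.B5G183RateTorus (cpt)
open Literature.MathematicalPhysics.QuantumFieldTheory.Balaban1983to89.B5G183RateTorusW (off)
open Literature.MathematicalPhysics.QuantumFieldTheory.Balaban1983to89.Beta (Site windowMap)
open Literature.MathematicalPhysics.QuantumFieldTheory.Balaban1983to89.Beta.FreeLegDictionary (cubic)
open Literature.MathematicalPhysics.QuantumFieldTheory.Balaban1983to89.Beta.VectorTails (castT)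
open Literature.MathematicalPhysics.QuantumFieldTheory.Balaban1983to89.Beta.VectorTailsCov (tdist tdist_comm)
open Literature.MathematicalPhysics.QuantumFieldTheory.Balaban1983to89.Beta.Composition (blockProp)
open Literature.MathematicalPhysics.QuantumFieldTheory.Balaban1983to89.Beta.CompositionSingular (minOp flucCov)
open Summit.QuantumFields.BalabanUV.T4Continuum.BalabanLineAverage (QB)
open Summit.QuantumFields.BalabanUV.T4Continuum.BalabanAveragedTowerModes (par rem par_cpt_add_off)
open Summit.QuantumFields.BalabanUV.Beta.GAN24.EffectiveFormLocalisation (transpose_reg blockProp_coercive_of_ub)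
open Summit.QuantumFields.BalabanUV.Beta.GAN24.FluctuationCovarianceLocalisation (mul_inv_apply_eq)
open Summit.QuantumFields.BalabanUV.Beta.GAN24.OneStepConstraintBlockGeometry (form_le_of_entry_decay_par not_corner_of_tree)
open Summit.QuantumFields.BalabanUV.Beta.GAN24.OneStepConstraintAxialLocalisation (abs_inv_mul_transpose_le_QB_axial abs_minOp_le_QB_axial ub_QB_axial)
open Summit.QuantumFields.BalabanUV.Beta.GAN24.VolumeLimitPairsRect (tendsto_mul_pair₃ tendsto_mul_pair₃' exp_neg_tdist_le_exp_window')
open Summit.QuantumFields.BalabanUV.Beta.GAN24.OneStepConstraintBlockPresentation (rho_bijective eps_bijective tree_cpt_add_off key_eps blocks_eq_of_ub)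
open Summit.QuantumFields.BalabanUV.Beta.GAN24.OneStepConstraintAxialVolumeLetters (tendsto_inv_regFormAx_rho)
open Summit.QuantumFields.BalabanUV.Beta.GAN24.OneStepConstraintAxialVolumeProp (tendsto_inv_mul_transpose_rho_eps tendsto_inv_blockProp_eps)

variable {d : ℕ} (N R : ℕ) [NeZero N] [NeZero R] (s : ℕ → ℕ) [hs0 : ∀ t, NeZero (s t)]

variable {Kf : ℝ → ℝ}

/-! ## §1 The hard minimiser `ℋ_t = K_t⁻¹Q_axᵀP_t⁻¹` at (fine, stacked) readings -/

/-- **`tendsto_minOp_rho_eps` — EL₂ OF THE HARD MINIMISER**: along `s t → ∞`, `ℋ_t(ρ(ẑ,f), ε(ẑ′,g)) = Σ_{b″} (K_t⁻¹Q_axᵀ)(ρ(ẑ,f), ε b″)·P_t⁻¹(ε b″, ε(ẑ′,g))` (PART 186 `blocks_eq_of_ub`,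
the stacked sum read through `ε`) converges: PART 185's rectangular product over the presented stacked index with the left factor decaying (PART 180's column letter, EL₂ by PART 188 §2)
and the right factor bounded by `Λ + a` (`QGQInverse.inv_entry_le_of_coercive` on PART 105's coercivity of `P_t`; EL₂ by PART 188 §4). [folklore] -/
theorem tendsto_minOp_rho_eps (hd : 1 ≤ d) (hs : Tendsto s atTop atTop) (hKf0 : ∀ s' : ℝ, 0 < s' → 0 ≤ Kf s')
    (hKf : ∀ s' : ℝ, 0 < s' → ∀ t (y : Tor (fine N (cubic d (s t)))), ∑ y' : Tor (fine N (cubic d (s t))), Real.exp (-(s' * (tdist y y' : ℝ))) ≤ Kf s')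
    {H : (t : ℕ) → Matrix (Tor (fine (R * N) (cubic d (s t))) × Fin d) (Tor (fine (R * N) (cubic d (s t))) × Fin d) ℝ} (hH : ∀ t, (H t)ᵀ = H t)
    (hpsd : ∀ t (u : Tor (fine (R * N) (cubic d (s t))) × Fin d → ℝ), 0 ≤ u ⬝ᵥ (H t *ᵥ u))
    {a h₀ δH γK : ℝ} (ha : 0 < a) (hh₀ : 0 ≤ h₀) (hδH : 0 < δH) (hγK : 0 < γK)
    (hHent : ∀ t (x x' : Tor (fine (R * N) (cubic d (s t))) × Fin d), |H t x x'| ≤ h₀ * Real.exp (-(δH * (tdist (par N R (cubic d (s t)) x.1) (par N R (cubic d (s t)) x'.1) : ℝ))))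
    (hK : ∀ t, QGQInverse.Coercive (H t + ((Matrix.fromRows (reM (QB N R (cubic d (s t)))) (fun (t' : {x : Tor (fine (R * N) (cubic d (s t))) × Fin d // (∀ ν, ν < x.2 → ((rem N R (cubic d (s t)) x.1 ν : ℕ)) = 0) ∧ ((rem N R (cubic d (s t)) x.1 x.2 : ℕ)) + 1 < R}) (x : Tor (fine (R * N) (cubic d (s t))) × Fin d) => if x = (Function.Embedding.subtype (fun x : Tor (fine (R * N) (cubic d (s t))) × Fin d => (∀ ν, ν < x.2 → ((rem N R (cubic d (s t)) x.1 ν : ℕ)) = 0) ∧ ((rem N R (cubic d (s t)) x.1 x.2 : ℕ)) + 1 < R)) t' then (1 : ℝ) else 0)))ᵀ * (a • (1 : Matrix ((Tor (fine N (cubic d (s t))) × Fin d) ⊕ {x : Tor (fine (R * N) (cubic d (s t))) × Fin d // (∀ ν, ν < x.2 → ((rem N R (cubic d (s t)) x.1 ν : ℕ)) = 0) ∧ ((rem N R (cubic d (s t)) x.1 x.2 : ℕ)) + 1 < R}) ((Tor (fine N (cubic d (s t))) × Fin d) ⊕ {x : Tor (fine (R * N) (cubic d (s t))) × Fin d // (∀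 ν, ν < x.2 → ((rem N R (cubic d (s t)) x.1 ν : ℕ)) = 0) ∧ ((rem N R (cubic d (s t)) x.1 x.2 : ℕ)) + 1 < R}) ℝ)) * (Matrix.fromRows (reM (QB N R (cubic d (s t)))) (fun (t' : {x : Tor (fine (R * N) (cubic d (s t))) × Fin d // (∀ ν, ν < x.2 → ((rem N R (cubic d (s t)) x.1 ν : ℕ)) = 0) ∧ ((rem N R (cubic d (s t)) x.1 x.2 : ℕ)) + 1 < R}) (x : Tor (fine (R * N) (cubic d (s t))) × Fin d) => if x = (Function.Embedding.subtype (fun x : Tor (fine (R * N) (cubic d (s t))) × Fin d => (∀ ν, ν < x.2 → ((rem N R (cubic d (s t)) x.1 ν : ℕ)) = 0) ∧ ((rem N R (cubic d (s t)) x.1 x.2 : ℕ)) + 1 < R)) t' then (1 : ℝ) else 0))) γK)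
    (hHlim : ∀ (f f' : (Fin d → Fin R) × Fin d) (z z' : Fin d → ℤ), ∃ c : ℝ, Tendsto (fun t => H t ((cpt N R (cubic d (s t)) ((castT (fine N (cubic d (s t))) z)) + off N R (cubic d (s t)) (f).1, (f).2) : Tor (fine (R * N) (cubic d (s t))) × Fin d) ((cpt N R (cubic d (s t)) ((castT (fine N (cubic d (s t))) z')) + off N R (cubic d (s t)) (f').1, (f').2) : Tor (fine (R * N) (cubic d (s t))) × Fin d)) atTop (𝓝 c))
    (f : (Fin d → Fin R) × Fin d) (g : Fin d ⊕ {f : (Fin d → Fin R) × Fin d // (∀ ν, ν < f.2 → ((f.1 ν : ℕ)) = 0) ∧ ((f.1 f.2 : ℕ)) + 1 < R}) (z z' : Fin d → ℤ) :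
    ∃ c : ℝ, Tendsto (fun t => minOp (H t) (Matrix.fromRows (reM (QB N R (cubic d (s t)))) (fun (t' : {x : Tor (fine (R * N) (cubic d (s t))) × Fin d // (∀ ν, ν < x.2 → ((rem N R (cubic d (s t)) x.1 ν : ℕ)) = 0) ∧ ((rem N R (cubic d (s t)) x.1 x.2 : ℕ)) + 1 < R}) (x : Tor (fine (R * N) (cubic d (s t))) × Fin d) => if x = (Function.Embedding.subtype (fun x : Tor (fine (R * N) (cubic d (s t))) × Fin d => (∀ ν, ν < x.2 → ((rem N R (cubic d (s t)) x.1 ν : ℕ)) = 0) ∧ ((rem N R (cubic d (s t)) x.1 x.2 : ℕ)) + 1 < R)) t' then (1 : ℝ) else 0)) ((cpt N R (cubic d (s t)) ((castT (fine N (cubic d (s t))) z)) + off N R (cubic d (s t)) (f).1, (f).2) : Tor (fine (R * N) (cubic d (s t))) × Fin d) (Sum.elim (fun μ : Fin d => (Sum.inl ((castT (fine N (cubic d (s t))) z'), μ) : ((Tor (fine N (cubic d (s t))) × Fin d) ⊕ {x : Tor (fine (R * N) (cubic d (s t))) × Fin d // (∀ ν, ν < x.2 → ((rem N R (cubic d (s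 t)) x.1 ν : ℕ)) = 0) ∧ ((rem N R (cubic d (s t)) x.1 x.2 : ℕ)) + 1 < R}))) (fun f : {f : (Fin d → Fin R) × Fin d // (∀ ν, ν < f.2 → ((f.1 ν : ℕ)) = 0) ∧ ((f.1 f.2 : ℕ)) + 1 < R} => Sum.inr ⟨(cpt N R (cubic d (s t)) ((castT (fine N (cubic d (s t))) z')) + off N R (cubic d (s t)) f.1.1, f.1.2), tree_cpt_add_off N R (cubic d (s t)) _ f⟩) (g))) atTop (𝓝 c) := by
  classical
  have hd0 : (0 : ℝ) < d := by exact_mod_cast lt_of_lt_of_le zero_lt_one hd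
  have hside : Tendsto (fun t => N * s t) atTop atTop :=
    Filter.tendsto_atTop_mono (fun t => Nat.le_mul_of_pos_left _ (Nat.pos_of_ne_zero (NeZero.ne N))) hs
  have hcK0 : 0 ≤ (h₀ + a * (((R : ℝ) ^ d)⁻¹ * ((R : ℝ) ^ d)⁻¹) * Real.exp (2 * δH)) + a := by positivity
  have hprof : ∀ s' : ℝ, 0 < s' → 0 ≤ (d : ℝ) * (R : ℝ) ^ d * Kf s' := fun s' hs' => by have := hKf0 s' hs'; positivity
  have hprofU : ∀ s' : ℝ, 0 < s' → 0 ≤ (d : ℝ) * (1 + (R : ℝ) ^ d) * Kf s' := fun s' hs' => by have := hKf0 s' hs'; positivity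
  have hrF0 : 0 < rate (fun s' => (d : ℝ) * (R : ℝ) ^ d * Kf s') γK ((h₀ + a * (((R : ℝ) ^ d)⁻¹ * ((R : ℝ) ^ d)⁻¹) * Real.exp (2 * δH)) + a) δH :=
    rate_pos hprof hγK hcK0 hδH
  have hh : 0 ≤ h₀ * ((d : ℝ) * (R : ℝ) ^ d * Kf δH) := mul_nonneg hh₀ (hprof δH hδH)
  have hΛ0 : 0 ≤ h₀ * ((d : ℝ) * (R : ℝ) ^ d * Kf δH) * (4 * ((R : ℝ) ^ d) ^ 2 * (1 + ((R : ℝ) ^ d)⁻¹) + 2 * 1) := by positivity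
  have hΛa : 0 < h₀ * ((d : ℝ) * (R : ℝ) ^ d * Kf δH) * (4 * ((R : ℝ) ^ d) ^ 2 * (1 + ((R : ℝ) ^ d)⁻¹) + 2 * 1) + a := by linarith
  have hHub : ∀ t (u : Tor (fine (R * N) (cubic d (s t))) × Fin d → ℝ), u ⬝ᵥ (H t *ᵥ u) ≤ h₀ * ((d : ℝ) * (R : ℝ) ^ d * Kf δH) * (u ⬝ᵥ u) :=
    fun t u => form_le_of_entry_decay_par N R (cubic d (s t)) (hH t) (fun s' hs' y => hKf s' hs' t y) hh₀ hδH (hHent t) u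
  have hUB := fun t => ub_QB_axial N R (cubic d (s t)) (Function.Embedding.subtype (fun x : Tor (fine (R * N) (cubic d (s t))) × Fin d => (∀ ν, ν < x.2 → ((rem N R (cubic d (s t)) x.1 ν : ℕ)) = 0) ∧ ((rem N R (cubic d (s t)) x.1 x.2 : ℕ)) + 1 < R)) (not_corner_of_tree N R (cubic d (s t))) hh (hHub t)
  have hblocks := fun t => blocks_eq_of_ub (hH t) (hpsd t) ha hγK (hK t) hΛ0 (hUB t)
  have hPco : ∀ t, QGQInverse.Coercive (blockProp (H t + ((Matrix.fromRows (reM (QB N R (cubic d (s t)))) (fun (t' : {x : Tor (fine (R * N) (cubic d (s t))) × Fin d // (∀ ν, ν < x.2 → ((rem N R (cubic d (s t)) x.1 ν : ℕ)) = 0) ∧ ((rem N R (cubic d (s t)) x.1 x.2 : ℕ)) + 1 < R}) (x : Tor (fine (R * N) (cubic d (s t))) × Fin d) => if x = (Function.Embedding.subtype (fun x : Tor (fine (R * N) (cubic d (s t))) × Fin d => (∀ ν, ν < x.2 → ((rem N R (cubic d (s t)) x.1 ν : ℕ)) = 0) ∧ ((rem N R (cubic d (s t)) x.1 x.2 : ℕ))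 + 1 < R)) t' then (1 : ℝ) else 0)))ᵀ * (a • (1 : Matrix ((Tor (fine N (cubic d (s t))) × Fin d) ⊕ {x : Tor (fine (R * N) (cubic d (s t))) × Fin d // (∀ ν, ν < x.2 → ((rem N R (cubic d (s t)) x.1 ν : ℕ)) = 0) ∧ ((rem N R (cubic d (s t)) x.1 x.2 : ℕ)) + 1 < R}) ((Tor (fine N (cubic d (s t))) × Fin d) ⊕ {x : Tor (fine (R * N) (cubic d (s t))) × Fin d // (∀ ν, ν < x.2 → ((rem N R (cubic d (s t)) x.1 ν : ℕ)) = 0) ∧ ((rem N R (cubic d (s t)) x.1 x.2 : ℕ)) + 1 < R}) ℝ)) * (Matrix.fromRows (reM (QB N R (cubic d (s t)))) (fun (t' : {x : Tor (fine (R * N) (cubic d (s t))) × Fin d // (∀ ν, ν < x.2 → ((rem N R (cubic d (s t)) x.1 ν : ℕ)) = 0) ∧ ((rem N R (cubic d (s t)) x.1 x.2 : ℕ)) + 1 < R}) (x : Tor (fine (R * N) (cubic d (s t))) × Fin d) => if x = (Function.Embedding.subtype (fun x : Tor (fine (R * N) (cubic d (s t))) × Fin d => (∀ ν, ν < x.2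 → ((rem N R (cubic d (s t)) x.1 ν : ℕ)) = 0) ∧ ((rem N R (cubic d (s t)) x.1 x.2 : ℕ)) + 1 < R)) t' then (1 : ℝ) else 0))) (Matrix.fromRows (reM (QB N R (cubic d (s t)))) (fun (t' : {x : Tor (fine (R * N) (cubic d (s t))) × Fin d // (∀ ν, ν < x.2 → ((rem N R (cubic d (s t)) x.1 ν : ℕ)) = 0) ∧ ((rem N R (cubic d (s t)) x.1 x.2 : ℕ)) + 1 < R}) (x : Tor (fine (R * N) (cubic d (s t))) × Fin d) => if x = (Function.Embedding.subtype (fun x : Tor (fine (R * N) (cubic d (s t))) × Fin d => (∀ ν, ν < x.2 → ((rem N R (cubic d (s t)) x.1 ν : ℕ)) = 0) ∧ ((rem N R (cubic d (s t)) x.1 x.2 : ℕ)) + 1 < R)) t' then (1 : ℝ) else 0))) (h₀ * ((d : ℝ) * (R : ℝ) ^ d * Kf δH) * (4 * ((R : ℝ) ^ d) ^ 2 * (1 + ((R : ℝ) ^ d)⁻¹) + 2 * 1) + a)⁻¹ :=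
    fun t => blockProp_coercive_of_ub (hH t) (hpsd t) ha hγK (hK t) hΛ0 (hUB t)
  -- PART 180's column letter `|(K⁻¹Q_axᵀ)(x,b)| ≤ c₁·e^{−r_F·tdist(par x, key b)}`
  have hcol : ∀ t (x : Tor (fine (R * N) (cubic d (s t))) × Fin d) (b : ((Tor (fine N (cubic d (s t))) × Fin d) ⊕ {x : Tor (fine (R * N) (cubic d (s t))) × Fin d // (∀ ν, ν < x.2 → ((rem N R (cubic d (s t)) x.1 ν : ℕ)) = 0) ∧ ((rem N R (cubic d (s t)) x.1 x.2 : ℕ)) + 1 < R})), |(((H t + ((Matrix.fromRows (reM (QB N R (cubic d (s t)))) (fun (t' : {x : Tor (fine (R * N) (cubic d (s t))) × Fin d // (∀ ν, ν < x.2 → ((rem N R (cubic d (s t)) x.1 ν : ℕ)) = 0) ∧ ((rem N R (cubic d (s t)) x.1 x.2 : ℕ)) + 1 < R}) (x : Tor (fine (R * N) (cubic d (s t))) × Fin d) => if x = (Function.Embedding.subtype (fun x : Tor (fine (R * N) (cubic d (s t))) × Fin d => (∀ ν, ν < x.2 → ((rem N R (cubic d (s t)) x.1 ν : ℕ)) =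 0) ∧ ((rem N R (cubic d (s t)) x.1 x.2 : ℕ)) + 1 < R)) t' then (1 : ℝ) else 0)))ᵀ * (a • (1 : Matrix ((Tor (fine N (cubic d (s t))) × Fin d) ⊕ {x : Tor (fine (R * N) (cubic d (s t))) × Fin d // (∀ ν, ν < x.2 → ((rem N R (cubic d (s t)) x.1 ν : ℕ)) = 0) ∧ ((rem N R (cubic d (s t)) x.1 x.2 : ℕ)) + 1 < R}) ((Tor (fine N (cubic d (s t))) × Fin d) ⊕ {x : Tor (fine (R * N) (cubic d (s t))) × Fin d // (∀ ν, ν < x.2 → ((rem N R (cubic d (s t)) x.1 ν : ℕ)) = 0) ∧ ((rem N R (cubic d (s t)) x.1 x.2 : ℕ)) + 1 < R}) ℝ)) * (Matrix.fromRows (reM (QB N R (cubic d (s t)))) (fun (t' : {x : Tor (fine (R * N) (cubic d (s t))) × Fin d // (∀ ν, ν < x.2 → ((rem N R (cubic d (s t)) x.1 ν : ℕ)) = 0) ∧ ((rem N R (cubic d (s t)) x.1 x.2 : ℕ)) + 1 < R}) (x : Tor (fine (R * N) (cubic d (s t))) × Fin d) => if x = (Function.Embedding.subtype (fun x : Tor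 (fine (R * N) (cubic d (s t))) × Fin d => (∀ ν, ν < x.2 → ((rem N R (cubic d (s t)) x.1 ν : ℕ)) = 0) ∧ ((rem N R (cubic d (s t)) x.1 x.2 : ℕ)) + 1 < R)) t' then (1 : ℝ) else 0))))⁻¹ * ((Matrix.fromRows (reM (QB N R (cubic d (s t)))) (fun (t' : {x : Tor (fine (R * N) (cubic d (s t))) × Fin d // (∀ ν, ν < x.2 → ((rem N R (cubic d (s t)) x.1 ν : ℕ)) = 0) ∧ ((rem N R (cubic d (s t)) x.1 x.2 : ℕ)) + 1 < R}) (x : Tor (fine (R * N) (cubic d (s t))) × Fin d) => if x = (Function.Embedding.subtype (fun x : Tor (fine (R * N) (cubic d (s t))) × Fin d => (∀ ν, ν < x.2 → ((rem N R (cubic d (s t)) x.1 ν : ℕ)) = 0) ∧ ((rem N R (cubic d (s t)) x.1 x.2 : ℕ)) + 1 < R)) t' then (1 : ℝ) else 0)))ᵀ) x b| ≤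
      2 / γK * Real.exp (rate (fun s' => (d : ℝ) * (R : ℝ) ^ d * Kf s') γK ((h₀ + a * (((R : ℝ) ^ d)⁻¹ * ((R : ℝ) ^ d)⁻¹) * Real.exp (2 * δH)) + a) δH) *
        Real.exp (-(rate (fun s' => (d : ℝ) * (R : ℝ) ^ d * Kf s') γK ((h₀ + a * (((R : ℝ) ^ d)⁻¹ * ((R : ℝ) ^ d)⁻¹) * Real.exp (2 * δH)) + a) δH *
          (tdist (par N R (cubic d (s t)) x.1) ((Sum.elim (fun b : Tor (fine N (cubic d (s t))) × Fin d => b.1) (fun t' : {x : Tor (fine (R * N) (cubic d (s t))) × Fin d // (∀ ν, ν < x.2 → ((rem N R (cubic d (s t)) x.1 ν : ℕ)) = 0) ∧ ((rem N R (cubic d (s t)) x.1 x.2 : ℕ)) + 1 < R} => par N R (cubic d (s t)) ((Function.Embedding.subtype (fun x : Tor (fine (R * N) (cubic d (s t))) × Fin d => (∀ ν, ν < x.2 → ((rem N R (cubic d (s t)) x.1 ν : ℕ)) = 0) ∧ ((rem N R (cubic d (s t)) x.1 x.2 : ℕ)) + 1 < R)) t').1)) b) : ℝ))) :=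
    fun t x b => abs_inv_mul_transpose_le_QB_axial N R (cubic d (s t)) _ hKf0 (fun s' hs' y => hKf s' hs' t y) (hH t) hγK ha hh₀ hδH (hK t) (hHent t) rfl rfl rfl x b
  have hPinv : ∀ t (b b' : ((Tor (fine N (cubic d (s t))) × Fin d) ⊕ {x : Tor (fine (R * N) (cubic d (s t))) × Fin d // (∀ ν, ν < x.2 → ((rem N R (cubic d (s t)) x.1 ν : ℕ)) = 0) ∧ ((rem N R (cubic d (s t)) x.1 x.2 : ℕ)) + 1 < R})), |(blockProp (H t + ((Matrix.fromRows (reM (QB N R (cubic d (s t)))) (fun (t' : {x : Tor (fine (R * N) (cubic d (s t))) × Fin d // (∀ ν, ν < x.2 → ((rem N R (cubic d (s t)) x.1 ν : ℕ)) = 0) ∧ ((rem N R (cubic d (s t)) x.1 x.2 : ℕ)) + 1 < R}) (x : Tor (fine (R * N) (cubic d (s t))) × Fin d) => if x = (Function.Embedding.subtype (fun x : Tor (fine (R * N) (cubic d (s t))) × Fin d => (∀ ν, ν < x.2 → ((rem N R (cubic d (s t)) x.1 ν : ℕ)) = 0) ∧ ((rem N R (cubic d (s t)) x.1 x.2 :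 ℕ)) + 1 < R)) t' then (1 : ℝ) else 0)))ᵀ * (a • (1 : Matrix ((Tor (fine N (cubic d (s t))) × Fin d) ⊕ {x : Tor (fine (R * N) (cubic d (s t))) × Fin d // (∀ ν, ν < x.2 → ((rem N R (cubic d (s t)) x.1 ν : ℕ)) = 0) ∧ ((rem N R (cubic d (s t)) x.1 x.2 : ℕ)) + 1 < R}) ((Tor (fine N (cubic d (s t))) × Fin d) ⊕ {x : Tor (fine (R * N) (cubic d (s t))) × Fin d // (∀ ν, ν < x.2 → ((rem N R (cubic d (s t)) x.1 ν : ℕ)) = 0) ∧ ((rem N R (cubic d (s t)) x.1 x.2 : ℕ)) + 1 < R}) ℝ)) * (Matrix.fromRows (reM (QB N R (cubic d (s t)))) (fun (t' : {x : Tor (fine (R * N) (cubic d (s t))) × Fin d // (∀ ν, ν < x.2 → ((rem N R (cubic d (s t)) x.1 ν : ℕ)) = 0) ∧ ((rem N R (cubic d (s t)) x.1 x.2 : ℕ)) + 1 < R}) (x : Tor (fine (R * N) (cubic d (s t))) × Fin d) => if x = (Function.Embedding.subtype (fun x : Tor (fine (R * N) (cubic d (s t))) × Fin d => (∀ ν,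 ν < x.2 → ((rem N R (cubic d (s t)) x.1 ν : ℕ)) = 0) ∧ ((rem N R (cubic d (s t)) x.1 x.2 : ℕ)) + 1 < R)) t' then (1 : ℝ) else 0))) (Matrix.fromRows (reM (QB N R (cubic d (s t)))) (fun (t' : {x : Tor (fine (R * N) (cubic d (s t))) × Fin d // (∀ ν, ν < x.2 → ((rem N R (cubic d (s t)) x.1 ν : ℕ)) = 0) ∧ ((rem N R (cubic d (s t)) x.1 x.2 : ℕ)) + 1 < R}) (x : Tor (fine (R * N) (cubic d (s t))) × Fin d) => if x = (Function.Embedding.subtype (fun x : Tor (fine (R * N) (cubic d (s t))) × Fin d => (∀ ν, ν < x.2 → ((rem N R (cubic d (s t)) x.1 ν : ℕ)) = 0) ∧ ((rem N R (cubic d (s t)) x.1 x.2 : ℕ)) + 1 < R)) t' then (1 : ℝ) else 0)))⁻¹ b b'| ≤ h₀ * ((d : ℝ) * (R : ℝ) ^ d * Kf δH) * (4 * ((R : ℝ) ^ d) ^ 2 * (1 + ((R : ℝ) ^ d)⁻¹) + 2 * 1) + a := by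
    intro t b b'
    have h := QGQInverse.inv_entry_le_of_coercive (inv_pos.mpr hΛa) (hPco t) b b'
    rwa [inv_inv] at h
  obtain ⟨S, hS⟩ := tendsto_mul_pair₃' (d := d) (side := fun t => N * s t) hside (F := (Fin d → Fin R) × Fin d) (G := Fin d ⊕ {f : (Fin d → Fin R) × Fin d // (∀ ν, ν < f.2 → ((f.1 ν : ℕ)) = 0) ∧ ((f.1 f.2 : ℕ)) + 1 < R}) (H := Fin d ⊕ {f : (Fin d → Fin R) × Fin d // (∀ ν, ν < f.2 → ((f.1 ν : ℕ)) = 0) ∧ ((f.1 f.2 : ℕ)) + 1 < R})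
    (X := fun t => Matrix.of fun (r : Tor (fine N (cubic d (s t))) × ((Fin d → Fin R) × Fin d)) (b : Tor (fine N (cubic d (s t))) × (Fin d ⊕ {f : (Fin d → Fin R) × Fin d // (∀ ν, ν < f.2 → ((f.1 ν : ℕ)) = 0) ∧ ((f.1 f.2 : ℕ)) + 1 < R})) =>
      (((((H t + ((Matrix.fromRows (reM (QB N R (cubic d (s t)))) (fun (t' : {x : Tor (fine (R * N) (cubic d (s t))) × Fin d // (∀ ν, ν < x.2 → ((rem N R (cubic d (s t)) x.1 ν : ℕ)) = 0) ∧ ((rem N R (cubic d (s t)) x.1 x.2 : ℕ)) + 1 < R}) (x : Tor (fine (R * N) (cubic d (s t))) × Fin d) => if x = (Function.Embedding.subtype (fun x : Tor (fine (R * N) (cubic d (s t))) × Fin d => (∀ ν, ν < x.2 → ((rem N R (cubic d (s t)) x.1 ν : ℕ)) = 0) ∧ ((rem N R (cubic d (s t)) x.1 x.2 : ℕ)) + 1 < R)) t' then (1 : ℝ) else 0)))ᵀ * (a • (1 : Matrix ((Tor (fine N (cubic d (s t))) × Fin d) ⊕ {x : Tor (fine (R * N) (cubic d (s t))) × Fin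 d // (∀ ν, ν < x.2 → ((rem N R (cubic d (s t)) x.1 ν : ℕ)) = 0) ∧ ((rem N R (cubic d (s t)) x.1 x.2 : ℕ)) + 1 < R}) ((Tor (fine N (cubic d (s t))) × Fin d) ⊕ {x : Tor (fine (R * N) (cubic d (s t))) × Fin d // (∀ ν, ν < x.2 → ((rem N R (cubic d (s t)) x.1 ν : ℕ)) = 0) ∧ ((rem N R (cubic d (s t)) x.1 x.2 : ℕ)) + 1 < R}) ℝ)) * (Matrix.fromRows (reM (QB N R (cubic d (s t)))) (fun (t' : {x : Tor (fine (R * N) (cubic d (s t))) × Fin d // (∀ ν, ν < x.2 → ((rem N R (cubic d (s t)) x.1 ν : ℕ)) = 0) ∧ ((rem N R (cubic d (s t)) x.1 x.2 : ℕ)) + 1 < R}) (x : Tor (fine (R * N) (cubic d (s t))) × Fin d) => if x = (Function.Embedding.subtype (fun x : Tor (fine (R * N) (cubic d (s t))) × Fin d => (∀ ν, ν < x.2 → ((rem N R (cubic d (s t)) x.1 ν : ℕ)) = 0) ∧ ((rem N R (cubic d (s t)) x.1 x.2 : ℕ)) + 1 < R)) t' then (1 : ℝ) else 0))))⁻¹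 * ((Matrix.fromRows (reM (QB N R (cubic d (s t)))) (fun (t' : {x : Tor (fine (R * N) (cubic d (s t))) × Fin d // (∀ ν, ν < x.2 → ((rem N R (cubic d (s t)) x.1 ν : ℕ)) = 0) ∧ ((rem N R (cubic d (s t)) x.1 x.2 : ℕ)) + 1 < R}) (x : Tor (fine (R * N) (cubic d (s t))) × Fin d) => if x = (Function.Embedding.subtype (fun x : Tor (fine (R * N) (cubic d (s t))) × Fin d => (∀ ν, ν < x.2 → ((rem N R (cubic d (s t)) x.1 ν : ℕ)) = 0) ∧ ((rem N R (cubic d (s t)) x.1 x.2 : ℕ)) + 1 < R)) t' then (1 : ℝ) else 0)))ᵀ) ((cpt N R (cubic d (s t)) (r.1) + off N R (cubic d (s t)) (r.2).1, (r.2).2) : Tor (fine (R * N) (cubic d (s t))) × Fin d) (Sum.elim (fun μ : Fin d => (Sum.inl (b.1, μ) : ((Tor (fine N (cubic d (s t))) × Fin d) ⊕ {x : Tor (fine (R * N) (cubic d (s t))) × Fin d // (∀ ν, ν < x.2 → ((rem N R (cubic d (s t)) x.1 ν : ℕ)) = 0) ∧ ((rem N R (cubic d (s t)) x.1 x.2 :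 ℕ)) + 1 < R}))) (fun f : {f : (Fin d → Fin R) × Fin d // (∀ ν, ν < f.2 → ((f.1 ν : ℕ)) = 0) ∧ ((f.1 f.2 : ℕ)) + 1 < R} => Sum.inr ⟨(cpt N R (cubic d (s t)) (b.1) + off N R (cubic d (s t)) f.1.1, f.1.2), tree_cpt_add_off N R (cubic d (s t)) _ f⟩) (b.2)) : ℝ) : ℂ))
    (Y := fun t => Matrix.of fun (b : Tor (fine N (cubic d (s t))) × (Fin d ⊕ {f : (Fin d → Fin R) × Fin d // (∀ ν, ν < f.2 → ((f.1 ν : ℕ)) = 0) ∧ ((f.1 f.2 : ℕ)) + 1 < R})) (b' : Tor (fine N (cubic d (s t))) × (Fin d ⊕ {f : (Fin d → Fin R) × Fin d // (∀ ν, ν < f.2 → ((f.1 ν : ℕ)) = 0) ∧ ((f.1 f.2 : ℕ)) + 1 < R})) =>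
      (((blockProp (H t + ((Matrix.fromRows (reM (QB N R (cubic d (s t)))) (fun (t' : {x : Tor (fine (R * N) (cubic d (s t))) × Fin d // (∀ ν, ν < x.2 → ((rem N R (cubic d (s t)) x.1 ν : ℕ)) = 0) ∧ ((rem N R (cubic d (s t)) x.1 x.2 : ℕ)) + 1 < R}) (x : Tor (fine (R * N) (cubic d (s t))) × Fin d) => if x = (Function.Embedding.subtype (fun x : Tor (fine (R * N) (cubic d (s t))) × Fin d => (∀ ν, ν < x.2 → ((rem N R (cubic d (s t)) x.1 ν : ℕ)) = 0) ∧ ((rem N R (cubic d (s t)) x.1 x.2 : ℕ)) + 1 < R)) t' then (1 : ℝ) else 0)))ᵀ * (a • (1 : Matrix ((Tor (fine N (cubic d (s t))) × Fin d) ⊕ {x : Tor (fine (R * N) (cubic d (s t))) × Fin d // (∀ ν, ν < x.2 → ((rem N R (cubic d (s t)) x.1 ν : ℕ)) = 0) ∧ ((rem N R (cubic d (s t)) x.1 x.2 : ℕ)) + 1 < R}) ((Tor (fine N (cubic d (s t))) × Fin d) ⊕ {x : Tor (fine (R * N) (cubic d (s t))) × Fin d // (∀ ν, ν < x.2 → ((rem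 N R (cubic d (s t)) x.1 ν : ℕ)) = 0) ∧ ((rem N R (cubic d (s t)) x.1 x.2 : ℕ)) + 1 < R}) ℝ)) * (Matrix.fromRows (reM (QB N R (cubic d (s t)))) (fun (t' : {x : Tor (fine (R * N) (cubic d (s t))) × Fin d // (∀ ν, ν < x.2 → ((rem N R (cubic d (s t)) x.1 ν : ℕ)) = 0) ∧ ((rem N R (cubic d (s t)) x.1 x.2 : ℕ)) + 1 < R}) (x : Tor (fine (R * N) (cubic d (s t))) × Fin d) => if x = (Function.Embedding.subtype (fun x : Tor (fine (R * N) (cubic d (s t))) × Fin d => (∀ ν, ν < x.2 → ((rem N R (cubic d (s t)) x.1 ν : ℕ)) = 0) ∧ ((rem N R (cubic d (s t)) x.1 x.2 : ℕ)) + 1 < R)) t' then (1 : ℝ) else 0))) (Matrix.fromRows (reM (QB N R (cubic d (s t)))) (fun (t' : {x : Tor (fine (R * N) (cubic d (s t))) × Fin d // (∀ ν, ν < x.2 → ((rem N R (cubic d (s t)) x.1 ν : ℕ)) = 0) ∧ ((rem N R (cubic d (s t)) x.1 x.2 : ℕ)) + 1 < R}) (x : Tor (fine (R * N) (cubic d (s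 t))) × Fin d) => if x = (Function.Embedding.subtype (fun x : Tor (fine (R * N) (cubic d (s t))) × Fin d => (∀ ν, ν < x.2 → ((rem N R (cubic d (s t)) x.1 ν : ℕ)) = 0) ∧ ((rem N R (cubic d (s t)) x.1 x.2 : ℕ)) + 1 < R)) t' then (1 : ℝ) else 0)))⁻¹ (Sum.elim (fun μ : Fin d => (Sum.inl (b.1, μ) : ((Tor (fine N (cubic d (s t))) × Fin d) ⊕ {x : Tor (fine (R * N) (cubic d (s t))) × Fin d // (∀ ν, ν < x.2 → ((rem N R (cubic d (s t)) x.1 ν : ℕ)) = 0) ∧ ((rem N R (cubic d (s t)) x.1 x.2 : ℕ)) + 1 < R}))) (fun f : {f : (Fin d → Fin R) × Fin d // (∀ ν, ν < f.2 → ((f.1 ν : ℕ)) = 0) ∧ ((f.1 f.2 : ℕ)) + 1 < R} => Sum.inr ⟨(cpt N R (cubic d (s t)) (b.1) + off N R (cubic d (s t)) f.1.1, f.1.2), tree_cpt_add_off N R (cubic d (s t)) _ f⟩) (b.2)) (Sum.elim (fun μ : Fin d => (Sum.inl (b'.1, μ) : ((Tor (fine N (cubic d (s t))) × Fin d) ⊕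 {x : Tor (fine (R * N) (cubic d (s t))) × Fin d // (∀ ν, ν < x.2 → ((rem N R (cubic d (s t)) x.1 ν : ℕ)) = 0) ∧ ((rem N R (cubic d (s t)) x.1 x.2 : ℕ)) + 1 < R}))) (fun f : {f : (Fin d → Fin R) × Fin d // (∀ ν, ν < f.2 → ((f.1 ν : ℕ)) = 0) ∧ ((f.1 f.2 : ℕ)) + 1 < R} => Sum.inr ⟨(cpt N R (cubic d (s t)) (b'.1) + off N R (cubic d (s t)) f.1.1, f.1.2), tree_cpt_add_off N R (cubic d (s t)) _ f⟩) (b'.2)) : ℝ) : ℂ))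
    (B := h₀ * ((d : ℝ) * (R : ℝ) ^ d * Kf δH) * (4 * ((R : ℝ) ^ d) ^ 2 * (1 + ((R : ℝ) ^ d)⁻¹) + 2 * 1) + a)
    (C := 2 / γK * Real.exp (rate (fun s' => (d : ℝ) * (R : ℝ) ^ d * Kf s') γK ((h₀ + a * (((R : ℝ) ^ d)⁻¹ * ((R : ℝ) ^ d)⁻¹) * Real.exp (2 * δH)) + a) δH))
    (δ := rate (fun s' => (d : ℝ) * (R : ℝ) ^ d * Kf s') γK ((h₀ + a * (((R : ℝ) ^ d)⁻¹ * ((R : ℝ) ^ d)⁻¹) * Real.exp (2 * δH)) + a) δH / d)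
    hΛa.le (by positivity)
    (fun t x f₁ w g₁ => by
      rw [Matrix.of_apply, Complex.norm_real, Real.norm_eq_abs]
      refine (hcol t _ _).trans ?_
      rw [par_cpt_add_off, key_eps]
      exact mul_le_mul_of_nonneg_left (exp_neg_tdist_le_exp_window' hd (N * s t) hrF0.le x w) (by positivity))
    (div_pos hrF0 hd0)
    (fun t w g₁ y g₂ => by
      rw [Matrix.of_apply, Complex.norm_real, Real.norm_eq_abs]
      exact hPinv t _ _)
    (fun f₁ g₁ u u' => by
      obtain ⟨c, hc⟩ := tendsto_inv_mul_transpose_rho_eps N R s hd hs hKf0 hKf hH ha hh₀ hδH hγK hHent hK hHlim f₁ g₁ u u'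
      exact ⟨(c : ℂ), ((Complex.continuous_ofReal.tendsto c).comp hc).congr fun t => rfl⟩)
    (fun g₁ g₂ u u' => by
      obtain ⟨c, hc⟩ := tendsto_inv_blockProp_eps N R s hd hs hKf0 hKf hH hpsd ha hh₀ hδH hγK hHent hK hHlim g₁ g₂ u u'
      exact ⟨(c : ℂ), ((Complex.continuous_ofReal.tendsto c).comp hc).congr fun t => rfl⟩)
    f g z z'
  refine ⟨S.re, ((Complex.continuous_re.tendsto S).comp hS).congr fun t => ?_⟩
  simp only [Function.comp_apply]
  rw [Matrix.mul_apply, Complex.re_sum, (hblocks t).2.1, Matrix.mul_apply]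
  rw [← (eps_bijective N R (cubic d (s t))).sum_comp (fun x => _ * _)]
  refine Finset.sum_congr rfl fun b'' _ => ?_
  rw [Matrix.of_apply, Matrix.of_apply, ← Complex.ofReal_mul, Complex.ofReal_re]

/-! ## §2 The gauge-fixed fluctuation covariance at fine readings -/

/-- **`tendsto_flucCov_rho` — EL₂ OF THE GAUGE-FIXED FLUCTUATION COVARIANCE `𝒢_t = flucCov(H_t, Q_ax)` AT FINE READINGS** (census V201′ (ε), generic in the fine form; `d ≥ 1`): for a
volume-indexed family `H_t` of symmetric fine forms with nonnegative form, `t`-uniform block entry decay `(h₀, δ_H)`, site profile `Kf`, coercivity `γ_K` of the regularisation and EL₂ at fine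
readings, `𝒢_t(ρ(ẑ,f), ρ(ẑ′,f′))` converges along `s t → ∞` for all readings: `𝒢 = K⁻¹ − ℋ·(Q_axK⁻¹)` (PART 186 `blocks_eq_of_ub`); the first term by PART 187, the second a rectangular pair
product over the presented stacked index — `ℋ` bounded (PART 180's minimiser letter) with EL₂ (§1), `Q_axK⁻¹ = (K⁻¹Q_axᵀ)ᵀ` decaying (PART 180's column letter) with EL₂ (PART 188 §2). [folklore] -/
theorem tendsto_flucCov_rho (hd : 1 ≤ d) (hs : Tendsto s atTop atTop) (hKf0 : ∀ s' : ℝ, 0 < s' → 0 ≤ Kf s')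
    (hKf : ∀ s' : ℝ, 0 < s' → ∀ t (y : Tor (fine N (cubic d (s t)))), ∑ y' : Tor (fine N (cubic d (s t))), Real.exp (-(s' * (tdist y y' : ℝ))) ≤ Kf s')
    {H : (t : ℕ) → Matrix (Tor (fine (R * N) (cubic d (s t))) × Fin d) (Tor (fine (R * N) (cubic d (s t))) × Fin d) ℝ} (hH : ∀ t, (H t)ᵀ = H t)
    (hpsd : ∀ t (u : Tor (fine (R * N) (cubic d (s t))) × Fin d → ℝ), 0 ≤ u ⬝ᵥ (H t *ᵥ u))
    {a h₀ δH γK : ℝ} (ha : 0 < a) (hh₀ : 0 ≤ h₀) (hδH : 0 < δH) (hγK : 0 < γK)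
    (hHent : ∀ t (x x' : Tor (fine (R * N) (cubic d (s t))) × Fin d), |H t x x'| ≤ h₀ * Real.exp (-(δH * (tdist (par N R (cubic d (s t)) x.1) (par N R (cubic d (s t)) x'.1) : ℝ))))
    (hK : ∀ t, QGQInverse.Coercive (H t + ((Matrix.fromRows (reM (QB N R (cubic d (s t)))) (fun (t' : {x : Tor (fine (R * N) (cubic d (s t))) × Fin d // (∀ ν, ν < x.2 → ((rem N R (cubic d (s t)) x.1 ν : ℕ)) = 0) ∧ ((rem N R (cubic d (s t)) x.1 x.2 : ℕ)) + 1 < R}) (x : Tor (fine (R * N) (cubic d (s t))) × Fin d) => if x = (Function.Embedding.subtype (fun x : Tor (fine (R * N) (cubic d (s t))) × Fin d => (∀ ν, ν < x.2 → ((rem N R (cubic d (s t)) x.1 ν : ℕ)) = 0) ∧ ((rem N R (cubic d (s t)) x.1 x.2 : ℕ)) + 1 < R)) t' then (1 : ℝ) else 0)))ᵀ * (a • (1 : Matrix ((Tor (fine N (cubic d (s t))) × Fin d) ⊕ {x : Tor (fine (R * N) (cubic d (s t))) × Fin d // (∀ ν, ν < x.2 → ((rem N R (cubic d (s t)) x.1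 ν : ℕ)) = 0) ∧ ((rem N R (cubic d (s t)) x.1 x.2 : ℕ)) + 1 < R}) ((Tor (fine N (cubic d (s t))) × Fin d) ⊕ {x : Tor (fine (R * N) (cubic d (s t))) × Fin d // (∀ ν, ν < x.2 → ((rem N R (cubic d (s t)) x.1 ν : ℕ)) = 0) ∧ ((rem N R (cubic d (s t)) x.1 x.2 : ℕ)) + 1 < R}) ℝ)) * (Matrix.fromRows (reM (QB N R (cubic d (s t)))) (fun (t' : {x : Tor (fine (R * N) (cubic d (s t))) × Fin d // (∀ ν, ν < x.2 → ((rem N R (cubic d (s t)) x.1 ν : ℕ)) = 0) ∧ ((rem N R (cubic d (s t)) x.1 x.2 : ℕ)) + 1 < R}) (x : Tor (fine (R * N) (cubic d (s t))) × Fin d) => if x = (Function.Embedding.subtype (fun x : Tor (fine (R * N) (cubic d (s t))) × Fin d => (∀ ν, ν < x.2 → ((rem N R (cubic d (s t)) x.1 ν : ℕ)) = 0) ∧ ((rem N R (cubic d (s t)) x.1 x.2 : ℕ)) + 1 < R)) t' then (1 : ℝ) else 0))) γK)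
    (hHlim : ∀ (f f' : (Fin d → Fin R) × Fin d) (z z' : Fin d → ℤ), ∃ c : ℝ, Tendsto (fun t => H t ((cpt N R (cubic d (s t)) ((castT (fine N (cubic d (s t))) z)) + off N R (cubic d (s t)) (f).1, (f).2) : Tor (fine (R * N) (cubic d (s t))) × Fin d) ((cpt N R (cubic d (s t)) ((castT (fine N (cubic d (s t))) z')) + off N R (cubic d (s t)) (f').1, (f').2) : Tor (fine (R * N) (cubic d (s t))) × Fin d)) atTop (𝓝 c))
    (f f' : (Fin d → Fin R) × Fin d) (z z' : Fin d → ℤ) :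
    ∃ c : ℝ, Tendsto (fun t => flucCov (H t) (Matrix.fromRows (reM (QB N R (cubic d (s t)))) (fun (t' : {x : Tor (fine (R * N) (cubic d (s t))) × Fin d // (∀ ν, ν < x.2 → ((rem N R (cubic d (s t)) x.1 ν : ℕ)) = 0) ∧ ((rem N R (cubic d (s t)) x.1 x.2 : ℕ)) + 1 < R}) (x : Tor (fine (R * N) (cubic d (s t))) × Fin d) => if x = (Function.Embedding.subtype (fun x : Tor (fine (R * N) (cubic d (s t))) × Fin d => (∀ ν, ν < x.2 → ((rem N R (cubic d (s t)) x.1 ν : ℕ)) = 0) ∧ ((rem N R (cubic d (s t)) x.1 x.2 : ℕ)) + 1 < R)) t' then (1 : ℝ) else 0)) ((cpt N R (cubic d (s t)) ((castT (fine N (cubic d (s t))) z)) + off N R (cubic d (s t)) (f).1, (f).2) : Tor (fine (R * N) (cubic d (s t))) × Fin d) ((cpt N R (cubic d (s t)) ((castT (fine N (cubic d (s t))) z')) + off N R (cubic d (s t)) (f').1, (f').2) : Tor (fine (R * N) (cubic d (s t))) × Fin d)) atTop (𝓝 c) := by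
  classical
  have hd0 : (0 : ℝ) < d := by exact_mod_cast lt_of_lt_of_le zero_lt_one hd
  have hside : Tendsto (fun t => N * s t) atTop atTop :=
    Filter.tendsto_atTop_mono (fun t => Nat.le_mul_of_pos_left _ (Nat.pos_of_ne_zero (NeZero.ne N))) hs
  have hcK0 : 0 ≤ (h₀ + a * (((R : ℝ) ^ d)⁻¹ * ((R : ℝ) ^ d)⁻¹) * Real.exp (2 * δH)) + a := by positivity
  have hprof : ∀ s' : ℝ, 0 < s' → 0 ≤ (d : ℝ) * (R : ℝ) ^ d * Kf s' := fun s' hs' => by have := hKf0 s' hs'; positivity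
  have hprofU : ∀ s' : ℝ, 0 < s' → 0 ≤ (d : ℝ) * (1 + (R : ℝ) ^ d) * Kf s' := fun s' hs' => by have := hKf0 s' hs'; positivity
  have hrF0 : 0 < rate (fun s' => (d : ℝ) * (R : ℝ) ^ d * Kf s') γK ((h₀ + a * (((R : ℝ) ^ d)⁻¹ * ((R : ℝ) ^ d)⁻¹) * Real.exp (2 * δH)) + a) δH :=
    rate_pos hprof hγK hcK0 hδH
  have hh : 0 ≤ h₀ * ((d : ℝ) * (R : ℝ) ^ d * Kf δH) := mul_nonneg hh₀ (hprof δH hδH)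
  have hΛ0 : 0 ≤ h₀ * ((d : ℝ) * (R : ℝ) ^ d * Kf δH) * (4 * ((R : ℝ) ^ d) ^ 2 * (1 + ((R : ℝ) ^ d)⁻¹) + 2 * 1) := by positivity
  have hΛa : 0 < h₀ * ((d : ℝ) * (R : ℝ) ^ d * Kf δH) * (4 * ((R : ℝ) ^ d) ^ 2 * (1 + ((R : ℝ) ^ d)⁻¹) + 2 * 1) + a := by linarith
  have hHub : ∀ t (u : Tor (fine (R * N) (cubic d (s t))) × Fin d → ℝ), u ⬝ᵥ (H t *ᵥ u) ≤ h₀ * ((d : ℝ) * (R : ℝ) ^ d * Kf δH) * (u ⬝ᵥ u) :=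
    fun t u => form_le_of_entry_decay_par N R (cubic d (s t)) (hH t) (fun s' hs' y => hKf s' hs' t y) hh₀ hδH (hHent t) u
  have hUB := fun t => ub_QB_axial N R (cubic d (s t)) (Function.Embedding.subtype (fun x : Tor (fine (R * N) (cubic d (s t))) × Fin d => (∀ ν, ν < x.2 → ((rem N R (cubic d (s t)) x.1 ν : ℕ)) = 0) ∧ ((rem N R (cubic d (s t)) x.1 x.2 : ℕ)) + 1 < R)) (not_corner_of_tree N R (cubic d (s t))) hh (hHub t)
  have hblocks := fun t => blocks_eq_of_ub (hH t) (hpsd t) ha hγK (hK t) hΛ0 (hUB t)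
  have hPco : ∀ t, QGQInverse.Coercive (blockProp (H t + ((Matrix.fromRows (reM (QB N R (cubic d (s t)))) (fun (t' : {x : Tor (fine (R * N) (cubic d (s t))) × Fin d // (∀ ν, ν < x.2 → ((rem N R (cubic d (s t)) x.1 ν : ℕ)) = 0) ∧ ((rem N R (cubic d (s t)) x.1 x.2 : ℕ)) + 1 < R}) (x : Tor (fine (R * N) (cubic d (s t))) × Fin d) => if x = (Function.Embedding.subtype (fun x : Tor (fine (R * N) (cubic d (s t))) × Fin d => (∀ ν, ν < x.2 → ((rem N R (cubic d (s t)) x.1 ν : ℕ)) = 0) ∧ ((rem N R (cubic d (s t)) x.1 x.2 : ℕ)) + 1 < R)) t' then (1 : ℝ) else 0)))ᵀ * (a • (1 : Matrix ((Tor (fine N (cubic d (s t))) × Fin d) ⊕ {x : Tor (fine (R * N) (cubic d (s t))) × Fin d // (∀ ν, ν < x.2 → ((rem N R (cubic d (s t)) x.1 ν : ℕ)) = 0) ∧ ((rem N R (cubic d (s t)) x.1 x.2 : ℕ)) + 1 < R}) ((Tor (fine N (cubic d (s t))) × Fin d) ⊕ {x : Tor (fine (R * N) (cubic d (s t))) ×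 Fin d // (∀ ν, ν < x.2 → ((rem N R (cubic d (s t)) x.1 ν : ℕ)) = 0) ∧ ((rem N R (cubic d (s t)) x.1 x.2 : ℕ)) + 1 < R}) ℝ)) * (Matrix.fromRows (reM (QB N R (cubic d (s t)))) (fun (t' : {x : Tor (fine (R * N) (cubic d (s t))) × Fin d // (∀ ν, ν < x.2 → ((rem N R (cubic d (s t)) x.1 ν : ℕ)) = 0) ∧ ((rem N R (cubic d (s t)) x.1 x.2 : ℕ)) + 1 < R}) (x : Tor (fine (R * N) (cubic d (s t))) × Fin d) => if x = (Function.Embedding.subtype (fun x : Tor (fine (R * N) (cubic d (s t))) × Fin d => (∀ ν, ν < x.2 → ((rem N R (cubic d (s t)) x.1 ν : ℕ)) = 0) ∧ ((rem N R (cubic d (s t)) x.1 x.2 : ℕ)) + 1 < R)) t' then (1 : ℝ) else 0))) (Matrix.fromRows (reM (QB N R (cubic d (s t)))) (fun (t' : {x : Tor (fine (R * N) (cubic d (s t))) × Fin d // (∀ ν, ν < x.2 → ((rem N R (cubic d (s t)) x.1 ν : ℕ)) = 0) ∧ ((rem N R (cubic d (s t)) x.1 x.2 : ℕ)) + 1 <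 R}) (x : Tor (fine (R * N) (cubic d (s t))) × Fin d) => if x = (Function.Embedding.subtype (fun x : Tor (fine (R * N) (cubic d (s t))) × Fin d => (∀ ν, ν < x.2 → ((rem N R (cubic d (s t)) x.1 ν : ℕ)) = 0) ∧ ((rem N R (cubic d (s t)) x.1 x.2 : ℕ)) + 1 < R)) t' then (1 : ℝ) else 0))) (h₀ * ((d : ℝ) * (R : ℝ) ^ d * Kf δH) * (4 * ((R : ℝ) ^ d) ^ 2 * (1 + ((R : ℝ) ^ d)⁻¹) + 2 * 1) + a)⁻¹ :=
    fun t => blockProp_coercive_of_ub (hH t) (hpsd t) ha hγK (hK t) hΛ0 (hUB t)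
  -- PART 180's column letter `|(K⁻¹Q_axᵀ)(x,b)| ≤ c₁·e^{−r_F·tdist(par x, key b)}`
  have hcol : ∀ t (x : Tor (fine (R * N) (cubic d (s t))) × Fin d) (b : ((Tor (fine N (cubic d (s t))) × Fin d) ⊕ {x : Tor (fine (R * N) (cubic d (s t))) × Fin d // (∀ ν, ν < x.2 → ((rem N R (cubic d (s t)) x.1 ν : ℕ)) = 0) ∧ ((rem N R (cubic d (s t)) x.1 x.2 : ℕ)) + 1 < R})), |(((H t + ((Matrix.fromRows (reM (QB N R (cubic d (s t)))) (fun (t' : {x : Tor (fine (R * N) (cubic d (s t))) × Fin d // (∀ ν, ν < x.2 → ((rem N R (cubic d (s t)) x.1 ν : ℕ)) = 0) ∧ ((rem N R (cubic d (s t)) x.1 x.2 : ℕ)) + 1 < R}) (x : Tor (fine (R * N) (cubic d (s t))) × Fin d) => if x = (Function.Embedding.subtype (fun x : Tor (fine (R * N) (cubic d (s t))) × Fin d => (∀ ν, ν < x.2 → ((rem N R (cubic d (s t)) x.1 ν : ℕ)) = 0) ∧ ((rem N R (cubic d (s t)) x.1 x.2 : ℕ)) + 1 < R)) t' then (1 :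 ℝ) else 0)))ᵀ * (a • (1 : Matrix ((Tor (fine N (cubic d (s t))) × Fin d) ⊕ {x : Tor (fine (R * N) (cubic d (s t))) × Fin d // (∀ ν, ν < x.2 → ((rem N R (cubic d (s t)) x.1 ν : ℕ)) = 0) ∧ ((rem N R (cubic d (s t)) x.1 x.2 : ℕ)) + 1 < R}) ((Tor (fine N (cubic d (s t))) × Fin d) ⊕ {x : Tor (fine (R * N) (cubic d (s t))) × Fin d // (∀ ν, ν < x.2 → ((rem N R (cubic d (s t)) x.1 ν : ℕ)) = 0) ∧ ((rem N R (cubic d (s t)) x.1 x.2 : ℕ)) + 1 < R}) ℝ)) * (Matrix.fromRows (reM (QB N R (cubic d (s t)))) (fun (t' : {x : Tor (fine (R * N) (cubic d (s t))) × Fin d // (∀ ν, ν < x.2 → ((rem N R (cubic d (s t)) x.1 ν : ℕ)) = 0) ∧ ((rem N R (cubic d (s t)) x.1 x.2 : ℕ)) + 1 < R}) (x : Tor (fine (R * N) (cubic d (s t))) × Fin d) => if x = (Function.Embedding.subtype (fun x : Tor (fine (R * N) (cubic d (s t))) × Fin d => (∀ ν, ν < x.2 → ((rem N R (cubic d (s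 t)) x.1 ν : ℕ)) = 0) ∧ ((rem N R (cubic d (s t)) x.1 x.2 : ℕ)) + 1 < R)) t' then (1 : ℝ) else 0))))⁻¹ * ((Matrix.fromRows (reM (QB N R (cubic d (s t)))) (fun (t' : {x : Tor (fine (R * N) (cubic d (s t))) × Fin d // (∀ ν, ν < x.2 → ((rem N R (cubic d (s t)) x.1 ν : ℕ)) = 0) ∧ ((rem N R (cubic d (s t)) x.1 x.2 : ℕ)) + 1 < R}) (x : Tor (fine (R * N) (cubic d (s t))) × Fin d) => if x = (Function.Embedding.subtype (fun x : Tor (fine (R * N) (cubic d (s t))) × Fin d => (∀ ν, ν < x.2 → ((rem N R (cubic d (s t)) x.1 ν : ℕ)) = 0) ∧ ((rem N R (cubic d (s t)) x.1 x.2 : ℕ)) + 1 < R)) t' then (1 : ℝ) else 0)))ᵀ) x b| ≤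
      2 / γK * Real.exp (rate (fun s' => (d : ℝ) * (R : ℝ) ^ d * Kf s') γK ((h₀ + a * (((R : ℝ) ^ d)⁻¹ * ((R : ℝ) ^ d)⁻¹) * Real.exp (2 * δH)) + a) δH) *
        Real.exp (-(rate (fun s' => (d : ℝ) * (R : ℝ) ^ d * Kf s') γK ((h₀ + a * (((R : ℝ) ^ d)⁻¹ * ((R : ℝ) ^ d)⁻¹) * Real.exp (2 * δH)) + a) δH *
          (tdist (par N R (cubic d (s t)) x.1) ((Sum.elim (fun b : Tor (fine N (cubic d (s t))) × Fin d => b.1) (fun t' : {x : Tor (fine (R * N) (cubic d (s t))) × Fin d // (∀ ν, ν < x.2 → ((rem N R (cubic d (s t)) x.1 ν : ℕ)) = 0) ∧ ((rem N R (cubic d (s t)) x.1 x.2 : ℕ)) + 1 < R} => par N R (cubic d (s t)) ((Function.Embedding.subtype (fun x : Tor (fine (R * N) (cubic d (s t))) × Fin d => (∀ ν, ν < x.2 → ((rem N R (cubic d (s t)) x.1 ν : ℕ)) = 0) ∧ ((rem N R (cubic d (s t)) x.1 x.2 : ℕ)) + 1 < R)) t').1)) b) : ℝ))) :=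
    fun t x b => abs_inv_mul_transpose_le_QB_axial N R (cubic d (s t)) _ hKf0 (fun s' hs' y => hKf s' hs' t y) (hH t) hγK ha hh₀ hδH (hK t) (hHent t) rfl rfl rfl x b
  -- PART 180's minimiser letter `|ℋ(x,b)| ≤ 2(Λ+a)c₁(d(1+R^d)Kf(m∕2))·e^{−…} ≤ 2(Λ+a)c₁(d(1+R^d)Kf(m∕2))`
  obtain ⟨rU, hrU⟩ : ∃ rU : ℝ, rU = rate (fun s' => (d : ℝ) * (1 + (R : ℝ) ^ d) * Kf s') (h₀ * ((d : ℝ) * (R : ℝ) ^ d * Kf δH) * (4 * ((R : ℝ) ^ d) ^ 2 * (1 + ((R : ℝ) ^ d)⁻¹) + 2 * 1) + a)⁻¹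
      (2 / γK * Real.exp (2 * rate (fun s' => (d : ℝ) * (R : ℝ) ^ d * Kf s') γK ((h₀ + a * (((R : ℝ) ^ d)⁻¹ * ((R : ℝ) ^ d)⁻¹) * Real.exp (2 * δH)) + a) δH))
      (rate (fun s' => (d : ℝ) * (R : ℝ) ^ d * Kf s') γK ((h₀ + a * (((R : ℝ) ^ d)⁻¹ * ((R : ℝ) ^ d)⁻¹) * Real.exp (2 * δH)) + a) δH) := ⟨_, rfl⟩
  obtain ⟨m, hm⟩ : ∃ m : ℝ, m = min (rate (fun s' => (d : ℝ) * (R : ℝ) ^ d * Kf s') γK ((h₀ + a * (((R : ℝ) ^ d)⁻¹ * ((R : ℝ) ^ d)⁻¹) * Real.exp (2 * δH)) + a) δH) rU := ⟨_, rfl⟩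
  have hrU0 : 0 < rU := by rw [hrU]; exact rate_pos hprofU (inv_pos.mpr hΛa) (by positivity) hrF0
  have hm0 : 0 < m := by rw [hm]; exact lt_min hrF0 hrU0
  have hmin : ∀ t (x : Tor (fine (R * N) (cubic d (s t))) × Fin d) (b : ((Tor (fine N (cubic d (s t))) × Fin d) ⊕ {x : Tor (fine (R * N) (cubic d (s t))) × Fin d // (∀ ν, ν < x.2 → ((rem N R (cubic d (s t)) x.1 ν : ℕ)) = 0) ∧ ((rem N R (cubic d (s t)) x.1 x.2 : ℕ)) + 1 < R})), |minOp (H t) (Matrix.fromRows (reM (QB N R (cubic d (s t)))) (fun (t' : {x : Tor (fine (R * N) (cubic d (s t))) × Fin d // (∀ ν, ν < x.2 → ((rem N R (cubic d (s t)) x.1 ν : ℕ)) = 0) ∧ ((rem N R (cubic d (s t)) x.1 x.2 : ℕ)) + 1 < R}) (x : Tor (fine (R * N) (cubic d (s t))) × Fin d) => if x = (Function.Embedding.subtype (fun x : Tor (fine (R * N) (cubic d (s t))) × Fin d => (∀ ν, ν < x.2 → ((rem N R (cubic d (s t)) x.1 ν : ℕ)) = 0) ∧ ((rem N R (cubic d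 (s t)) x.1 x.2 : ℕ)) + 1 < R)) t' then (1 : ℝ) else 0)) x b| ≤
      2 * (h₀ * ((d : ℝ) * (R : ℝ) ^ d * Kf δH) * (4 * ((R : ℝ) ^ d) ^ 2 * (1 + ((R : ℝ) ^ d)⁻¹) + 2 * 1) + a) *
        (2 / γK * Real.exp (rate (fun s' => (d : ℝ) * (R : ℝ) ^ d * Kf s') γK ((h₀ + a * (((R : ℝ) ^ d)⁻¹ * ((R : ℝ) ^ d)⁻¹) * Real.exp (2 * δH)) + a) δH)) *
        ((d : ℝ) * (1 + (R : ℝ) ^ d) * Kf (m / 2)) := by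
    intro t x b
    have hKfm : 0 ≤ (d : ℝ) * (1 + (R : ℝ) ^ d) * Kf (m / 2) := hprofU _ (by linarith)
    refine (abs_minOp_le_QB_axial N R (cubic d (s t)) _ (not_corner_of_tree N R (cubic d (s t))) hKf0 (fun s' hs' y => hKf s' hs' t y) (hH t) (hpsd t) hh (hHub t) hγK ha hh₀ hδH (hK t) (hHent t)
      rfl rfl rfl rfl rfl hrU hm x b).trans ?_
    refine mul_le_of_le_one_right (by positivity) ?_
    rw [Real.exp_le_one_iff, neg_nonpos]
    exact mul_nonneg (by linarith) (Nat.cast_nonneg _)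
  obtain ⟨S, hS⟩ := tendsto_mul_pair₃ (d := d) (side := fun t => N * s t) hside (F := (Fin d → Fin R) × Fin d) (G := Fin d ⊕ {f : (Fin d → Fin R) × Fin d // (∀ ν, ν < f.2 → ((f.1 ν : ℕ)) = 0) ∧ ((f.1 f.2 : ℕ)) + 1 < R}) (H := (Fin d → Fin R) × Fin d)
    (X := fun t => Matrix.of fun (r : Tor (fine N (cubic d (s t))) × ((Fin d → Fin R) × Fin d)) (b : Tor (fine N (cubic d (s t))) × (Fin d ⊕ {f : (Fin d → Fin R) × Fin d // (∀ ν, ν < f.2 → ((f.1 ν : ℕ)) = 0) ∧ ((f.1 f.2 : ℕ)) + 1 < R})) =>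
      ((minOp (H t) (Matrix.fromRows (reM (QB N R (cubic d (s t)))) (fun (t' : {x : Tor (fine (R * N) (cubic d (s t))) × Fin d // (∀ ν, ν < x.2 → ((rem N R (cubic d (s t)) x.1 ν : ℕ)) = 0) ∧ ((rem N R (cubic d (s t)) x.1 x.2 : ℕ)) + 1 < R}) (x : Tor (fine (R * N) (cubic d (s t))) × Fin d) => if x = (Function.Embedding.subtype (fun x : Tor (fine (R * N) (cubic d (s t))) × Fin d => (∀ ν, ν < x.2 → ((rem N R (cubic d (s t)) x.1 ν : ℕ)) = 0) ∧ ((rem N R (cubic d (s t)) x.1 x.2 : ℕ)) + 1 < R)) t' then (1 : ℝ) else 0)) ((cpt N R (cubic d (s t)) (r.1) + off N R (cubic d (s t)) (r.2).1, (r.2).2) : Tor (fine (R * N) (cubic d (s t))) × Fin d) (Sum.elim (fun μ : Fin d => (Sum.inl (b.1, μ) : ((Tor (fine N (cubic d (s t))) × Fin d) ⊕ {x : Tor (fine (R * N) (cubic d (s t))) × Fin d // (∀ ν, ν < x.2 → ((rem N R (cubic d (s t)) x.1 ν : ℕ)) = 0) ∧ ((rem N R (cubic d (s t)) x.1 x.2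 : ℕ)) + 1 < R}))) (fun f : {f : (Fin d → Fin R) × Fin d // (∀ ν, ν < f.2 → ((f.1 ν : ℕ)) = 0) ∧ ((f.1 f.2 : ℕ)) + 1 < R} => Sum.inr ⟨(cpt N R (cubic d (s t)) (b.1) + off N R (cubic d (s t)) f.1.1, f.1.2), tree_cpt_add_off N R (cubic d (s t)) _ f⟩) (b.2)) : ℝ) : ℂ))
    (Y := fun t => Matrix.of fun (b : Tor (fine N (cubic d (s t))) × (Fin d ⊕ {f : (Fin d → Fin R) × Fin d // (∀ ν, ν < f.2 → ((f.1 ν : ℕ)) = 0) ∧ ((f.1 f.2 : ℕ)) + 1 < R})) (r' : Tor (fine N (cubic d (s t))) × ((Fin d → Fin R) × Fin d)) =>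
      ((((Matrix.fromRows (reM (QB N R (cubic d (s t)))) (fun (t' : {x : Tor (fine (R * N) (cubic d (s t))) × Fin d // (∀ ν, ν < x.2 → ((rem N R (cubic d (s t)) x.1 ν : ℕ)) = 0) ∧ ((rem N R (cubic d (s t)) x.1 x.2 : ℕ)) + 1 < R}) (x : Tor (fine (R * N) (cubic d (s t))) × Fin d) => if x = (Function.Embedding.subtype (fun x : Tor (fine (R * N) (cubic d (s t))) × Fin d => (∀ ν, ν < x.2 → ((rem N R (cubic d (s t)) x.1 ν : ℕ)) = 0) ∧ ((rem N R (cubic d (s t)) x.1 x.2 : ℕ)) + 1 < R)) t' then (1 : ℝ) else 0)) * ((H t + ((Matrix.fromRows (reM (QB N R (cubic d (s t)))) (fun (t' : {x : Tor (fine (R * N) (cubic d (s t))) × Fin d // (∀ ν, ν < x.2 → ((rem N R (cubic d (s t)) x.1 ν : ℕ)) = 0) ∧ ((rem N R (cubic d (s t)) x.1 x.2 : ℕ)) + 1 < R}) (x : Tor (fine (R * N) (cubic d (s t))) × Fin d) => if x = (Function.Embedding.subtype (fun x : Tor (fine (R * N) (cubic d (s t))) × Fin d => (∀ ν, ν < x.2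 → ((rem N R (cubic d (s t)) x.1 ν : ℕ)) = 0) ∧ ((rem N R (cubic d (s t)) x.1 x.2 : ℕ)) + 1 < R)) t' then (1 : ℝ) else 0)))ᵀ * (a • (1 : Matrix ((Tor (fine N (cubic d (s t))) × Fin d) ⊕ {x : Tor (fine (R * N) (cubic d (s t))) × Fin d // (∀ ν, ν < x.2 → ((rem N R (cubic d (s t)) x.1 ν : ℕ)) = 0) ∧ ((rem N R (cubic d (s t)) x.1 x.2 : ℕ)) + 1 < R}) ((Tor (fine N (cubic d (s t))) × Fin d) ⊕ {x : Tor (fine (R * N) (cubic d (s t))) × Fin d // (∀ ν, ν < x.2 → ((rem N R (cubic d (s t)) x.1 ν : ℕ)) = 0) ∧ ((rem N R (cubic d (s t)) x.1 x.2 : ℕ)) + 1 < R}) ℝ)) * (Matrix.fromRows (reM (QB N R (cubic d (s t)))) (fun (t' : {x : Tor (fine (R * N) (cubic d (s t))) × Fin d // (∀ ν, ν < x.2 → ((rem N R (cubic d (s t)) x.1 ν : ℕ)) = 0) ∧ ((rem N R (cubic d (s t)) x.1 x.2 : ℕ)) + 1 < R}) (x : Tor (fine (R * N) (cubic d (s t)))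 × Fin d) => if x = (Function.Embedding.subtype (fun x : Tor (fine (R * N) (cubic d (s t))) × Fin d => (∀ ν, ν < x.2 → ((rem N R (cubic d (s t)) x.1 ν : ℕ)) = 0) ∧ ((rem N R (cubic d (s t)) x.1 x.2 : ℕ)) + 1 < R)) t' then (1 : ℝ) else 0))))⁻¹) (Sum.elim (fun μ : Fin d => (Sum.inl (b.1, μ) : ((Tor (fine N (cubic d (s t))) × Fin d) ⊕ {x : Tor (fine (R * N) (cubic d (s t))) × Fin d // (∀ ν, ν < x.2 → ((rem N R (cubic d (s t)) x.1 ν : ℕ)) = 0) ∧ ((rem N R (cubic d (s t)) x.1 x.2 : ℕ)) + 1 < R}))) (fun f : {f : (Fin d → Fin R) × Fin d // (∀ ν, ν < f.2 → ((f.1 ν : ℕ)) = 0) ∧ ((f.1 f.2 : ℕ)) + 1 < R} => Sum.inr ⟨(cpt N R (cubic d (s t)) (b.1) + off N R (cubic d (s t)) f.1.1, f.1.2), tree_cpt_add_off N R (cubic d (s t)) _ f⟩) (b.2)) ((cpt N R (cubic d (s t)) (r'.1) + off N R (cubic d (s t)) (r'.2).1, (r'.2).2) : Tor (fine (R * N)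 (cubic d (s t))) × Fin d) : ℝ) : ℂ))
    (B := 2 * (h₀ * ((d : ℝ) * (R : ℝ) ^ d * Kf δH) * (4 * ((R : ℝ) ^ d) ^ 2 * (1 + ((R : ℝ) ^ d)⁻¹) + 2 * 1) + a) *
        (2 / γK * Real.exp (rate (fun s' => (d : ℝ) * (R : ℝ) ^ d * Kf s') γK ((h₀ + a * (((R : ℝ) ^ d)⁻¹ * ((R : ℝ) ^ d)⁻¹) * Real.exp (2 * δH)) + a) δH)) *
        ((d : ℝ) * (1 + (R : ℝ) ^ d) * Kf (m / 2)))
    (C := 2 / γK * Real.exp (rate (fun s' => (d : ℝ) * (R : ℝ) ^ d * Kf s') γK ((h₀ + a * (((R : ℝ) ^ d)⁻¹ * ((R : ℝ) ^ d)⁻¹) * Real.exp (2 * δH)) + a) δH))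
    (δ := rate (fun s' => (d : ℝ) * (R : ℝ) ^ d * Kf s') γK ((h₀ + a * (((R : ℝ) ^ d)⁻¹ * ((R : ℝ) ^ d)⁻¹) * Real.exp (2 * δH)) + a) δH / d)
    (by have := hprofU (m / 2) (by linarith); positivity) (by positivity)
    (fun t x f₁ w g₁ => by
      rw [Matrix.of_apply, Complex.norm_real, Real.norm_eq_abs]
      exact hmin t _ _)
    (fun t w g₁ y h₁ => by
      rw [Matrix.of_apply, Complex.norm_real, Real.norm_eq_abs, mul_inv_apply_eq (transpose_reg (hH t) a)]
      refine (hcol t _ _).trans ?_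
      rw [par_cpt_add_off, key_eps]
      exact mul_le_mul_of_nonneg_left (exp_neg_tdist_le_exp_window' hd (N * s t) hrF0.le y w) (by positivity))
    (div_pos hrF0 hd0)
    (fun f₁ g₁ u u' => by
      obtain ⟨c, hc⟩ := tendsto_minOp_rho_eps N R s hd hs hKf0 hKf hH hpsd ha hh₀ hδH hγK hHent hK hHlim f₁ g₁ u u'
      exact ⟨(c : ℂ), ((Complex.continuous_ofReal.tendsto c).comp hc).congr fun t => rfl⟩)
    (fun g₁ h₁ u u' => by
      obtain ⟨c, hc⟩ := tendsto_inv_mul_transpose_rho_eps N R s hd hs hKf0 hKf hH ha hh₀ hδH hγK hHent hK hHlim h₁ g₁ u' u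
      exact ⟨(c : ℂ), ((Complex.continuous_ofReal.tendsto c).comp hc).congr fun t => by
        simp only [Function.comp_apply, Matrix.of_apply]; rw [mul_inv_apply_eq (transpose_reg (hH t) a)]⟩)
    f f' z z'
  obtain ⟨cK, hcK⟩ := tendsto_inv_regFormAx_rho N R s hd hs hKf hH ha hh₀ hδH hγK hHent hK hHlim f f' z z'
  refine ⟨cK - S.re, (hcK.sub ((Complex.continuous_re.tendsto S).comp hS)).congr fun t => ?_⟩
  simp only [Function.comp_apply]
  rw [(hblocks t).2.2, Matrix.sub_apply]
  congr 1
  rw [Matrix.mul_assoc (((H t + ((Matrix.fromRows (reM (QB N R (cubic d (s t)))) (fun (t' : {x : Tor (fine (R * N) (cubic d (s t))) × Fin d // (∀ ν, ν < x.2 → ((rem N R (cubic d (s t)) x.1 ν : ℕ)) = 0) ∧ ((rem N R (cubic d (s t)) x.1 x.2 : ℕ)) + 1 < R}) (x : Tor (fine (R * N) (cubic d (s t))) × Fin d) => if x = (Function.Embedding.subtype (fun x : Tor (fine (R * N) (cubic d (s t))) × Fin d => (∀ ν, ν < x.2 → ((rem N R (cubic d (s t)) x.1 ν : ℕ)) =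 0) ∧ ((rem N R (cubic d (s t)) x.1 x.2 : ℕ)) + 1 < R)) t' then (1 : ℝ) else 0)))ᵀ * (a • (1 : Matrix ((Tor (fine N (cubic d (s t))) × Fin d) ⊕ {x : Tor (fine (R * N) (cubic d (s t))) × Fin d // (∀ ν, ν < x.2 → ((rem N R (cubic d (s t)) x.1 ν : ℕ)) = 0) ∧ ((rem N R (cubic d (s t)) x.1 x.2 : ℕ)) + 1 < R}) ((Tor (fine N (cubic d (s t))) × Fin d) ⊕ {x : Tor (fine (R * N) (cubic d (s t))) × Fin d // (∀ ν, ν < x.2 → ((rem N R (cubic d (s t)) x.1 ν : ℕ)) = 0) ∧ ((rem N R (cubic d (s t)) x.1 x.2 : ℕ)) + 1 < R}) ℝ)) * (Matrix.fromRows (reM (QB N R (cubic d (s t)))) (fun (t' : {x : Tor (fine (R * N) (cubic d (s t))) × Fin d // (∀ ν, ν < x.2 → ((rem N R (cubic d (s t)) x.1 ν : ℕ)) = 0) ∧ ((rem N R (cubic d (s t)) x.1 x.2 : ℕ)) + 1 < R}) (x : Tor (fine (R * N) (cubic d (s t))) × Fin d) => if x = (Function.Embedding.subtype (fun x : Tor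 (fine (R * N) (cubic d (s t))) × Fin d => (∀ ν, ν < x.2 → ((rem N R (cubic d (s t)) x.1 ν : ℕ)) = 0) ∧ ((rem N R (cubic d (s t)) x.1 x.2 : ℕ)) + 1 < R)) t' then (1 : ℝ) else 0))))⁻¹ * ((Matrix.fromRows (reM (QB N R (cubic d (s t)))) (fun (t' : {x : Tor (fine (R * N) (cubic d (s t))) × Fin d // (∀ ν, ν < x.2 → ((rem N R (cubic d (s t)) x.1 ν : ℕ)) = 0) ∧ ((rem N R (cubic d (s t)) x.1 x.2 : ℕ)) + 1 < R}) (x : Tor (fine (R * N) (cubic d (s t))) × Fin d) => if x = (Function.Embedding.subtype (fun x : Tor (fine (R * N) (cubic d (s t))) × Fin d => (∀ ν, ν < x.2 → ((rem N R (cubic d (s t)) x.1 ν : ℕ)) = 0) ∧ ((rem N R (cubic d (s t)) x.1 x.2 : ℕ)) + 1 < R)) t' then (1 : ℝ) else 0)))ᵀ * (blockProp (H t + ((Matrix.fromRows (reM (QB N R (cubic d (s t)))) (fun (t' : {x : Tor (fine (R * N) (cubic d (s t))) × Fin d // (∀ ν, ν < x.2 → ((rem N R (cubic d (s t)) x.1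 ν : ℕ)) = 0) ∧ ((rem N R (cubic d (s t)) x.1 x.2 : ℕ)) + 1 < R}) (x : Tor (fine (R * N) (cubic d (s t))) × Fin d) => if x = (Function.Embedding.subtype (fun x : Tor (fine (R * N) (cubic d (s t))) × Fin d => (∀ ν, ν < x.2 → ((rem N R (cubic d (s t)) x.1 ν : ℕ)) = 0) ∧ ((rem N R (cubic d (s t)) x.1 x.2 : ℕ)) + 1 < R)) t' then (1 : ℝ) else 0)))ᵀ * (a • (1 : Matrix ((Tor (fine N (cubic d (s t))) × Fin d) ⊕ {x : Tor (fine (R * N) (cubic d (s t))) × Fin d // (∀ ν, ν < x.2 → ((rem N R (cubic d (s t)) x.1 ν : ℕ)) = 0) ∧ ((rem N R (cubic d (s t)) x.1 x.2 : ℕ)) + 1 < R}) ((Tor (fine N (cubic d (s t))) × Fin d) ⊕ {x : Tor (fine (R * N) (cubic d (s t))) × Fin d // (∀ ν, ν < x.2 → ((rem N R (cubic d (s t)) x.1 ν : ℕ)) = 0) ∧ ((rem N R (cubic d (s t)) x.1 x.2 : ℕ)) + 1 < R}) ℝ)) * (Matrix.fromRows (reM (QB N R (cubic d (s t)))) (fun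 (t' : {x : Tor (fine (R * N) (cubic d (s t))) × Fin d // (∀ ν, ν < x.2 → ((rem N R (cubic d (s t)) x.1 ν : ℕ)) = 0) ∧ ((rem N R (cubic d (s t)) x.1 x.2 : ℕ)) + 1 < R}) (x : Tor (fine (R * N) (cubic d (s t))) × Fin d) => if x = (Function.Embedding.subtype (fun x : Tor (fine (R * N) (cubic d (s t))) × Fin d => (∀ ν, ν < x.2 → ((rem N R (cubic d (s t)) x.1 ν : ℕ)) = 0) ∧ ((rem N R (cubic d (s t)) x.1 x.2 : ℕ)) + 1 < R)) t' then (1 : ℝ) else 0))) (Matrix.fromRows (reM (QB N R (cubic d (s t)))) (fun (t' : {x : Tor (fine (R * N) (cubic d (s t))) × Fin d // (∀ ν, ν < x.2 → ((rem N R (cubic d (s t)) x.1 ν : ℕ)) = 0) ∧ ((rem N R (cubic d (s t)) x.1 x.2 : ℕ)) + 1 < R}) (x : Tor (fine (R * N) (cubic d (s t))) × Fin d) => if x = (Function.Embedding.subtype (fun x : Tor (fine (R * N) (cubic d (s t))) × Fin d => (∀ ν, ν < x.2 → ((rem N R (cubic d (s t)) x.1 ν : ℕ)) = 0) ∧ ((rem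 N R (cubic d (s t)) x.1 x.2 : ℕ)) + 1 < R)) t' then (1 : ℝ) else 0)))⁻¹) ((Matrix.fromRows (reM (QB N R (cubic d (s t)))) (fun (t' : {x : Tor (fine (R * N) (cubic d (s t))) × Fin d // (∀ ν, ν < x.2 → ((rem N R (cubic d (s t)) x.1 ν : ℕ)) = 0) ∧ ((rem N R (cubic d (s t)) x.1 x.2 : ℕ)) + 1 < R}) (x : Tor (fine (R * N) (cubic d (s t))) × Fin d) => if x = (Function.Embedding.subtype (fun x : Tor (fine (R * N) (cubic d (s t))) × Fin d => (∀ ν, ν < x.2 → ((rem N R (cubic d (s t)) x.1 ν : ℕ)) = 0) ∧ ((rem N R (cubic d (s t)) x.1 x.2 : ℕ)) + 1 < R)) t' then (1 : ℝ) else 0))) (((H t + ((Matrix.fromRows (reM (QB N R (cubic d (s t)))) (fun (t' : {x : Tor (fine (R * N) (cubic d (s t))) × Fin d // (∀ ν, ν < x.2 → ((rem N R (cubic d (s t)) x.1 ν : ℕ)) = 0) ∧ ((rem N R (cubic d (s t)) x.1 x.2 : ℕ)) + 1 < R}) (x : Tor (fine (R * N) (cubic d (s t))) × Fin d) => if x =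 (Function.Embedding.subtype (fun x : Tor (fine (R * N) (cubic d (s t))) × Fin d => (∀ ν, ν < x.2 → ((rem N R (cubic d (s t)) x.1 ν : ℕ)) = 0) ∧ ((rem N R (cubic d (s t)) x.1 x.2 : ℕ)) + 1 < R)) t' then (1 : ℝ) else 0)))ᵀ * (a • (1 : Matrix ((Tor (fine N (cubic d (s t))) × Fin d) ⊕ {x : Tor (fine (R * N) (cubic d (s t))) × Fin d // (∀ ν, ν < x.2 → ((rem N R (cubic d (s t)) x.1 ν : ℕ)) = 0) ∧ ((rem N R (cubic d (s t)) x.1 x.2 : ℕ)) + 1 < R}) ((Tor (fine N (cubic d (s t))) × Fin d) ⊕ {x : Tor (fine (R * N) (cubic d (s t))) × Fin d // (∀ ν, ν < x.2 → ((rem N R (cubic d (s t)) x.1 ν : ℕ)) = 0) ∧ ((rem N R (cubic d (s t)) x.1 x.2 : ℕ)) + 1 < R}) ℝ)) * (Matrix.fromRows (reM (QB N R (cubic d (s t)))) (fun (t' : {x : Tor (fine (R * N) (cubic d (s t))) × Fin d // (∀ ν, ν < x.2 → ((rem N R (cubic d (s t)) x.1 ν : ℕ)) = 0) ∧ ((rem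 N R (cubic d (s t)) x.1 x.2 : ℕ)) + 1 < R}) (x : Tor (fine (R * N) (cubic d (s t))) × Fin d) => if x = (Function.Embedding.subtype (fun x : Tor (fine (R * N) (cubic d (s t))) × Fin d => (∀ ν, ν < x.2 → ((rem N R (cubic d (s t)) x.1 ν : ℕ)) = 0) ∧ ((rem N R (cubic d (s t)) x.1 x.2 : ℕ)) + 1 < R)) t' then (1 : ℝ) else 0))))⁻¹), ← (hblocks t).2.1]
  rw [Matrix.mul_apply, Complex.re_sum, Matrix.mul_apply]
  rw [← (eps_bijective N R (cubic d (s t))).sum_comp (fun x => _ * _)]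
  refine Finset.sum_congr rfl fun b'' _ => ?_
  rw [Matrix.of_apply, Matrix.of_apply, ← Complex.ofReal_mul, Complex.ofReal_re]

end Summit.QuantumFields.BalabanUV.Beta.GAN24.OneStepConstraintAxialVolumeLimit

end
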